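import Literature.NumberTheory.EllipticCurves.PadicSigmaVeluKernelBridgeProofs
import HarnessLib

/-!
# Blakestad–Grant's bridge lemmas for `a₁ = a₃ = 0` models (the `a₂`-term kept): the image of the
# formal point under a Vélu isogeny, its differential, and the congruences `u ≡ 1`, `t_p ≡ ℓ₀tᵖ`
# (module M3a of the x1a design for the Mazur–Tate sigma function at `p = 3`)

HONEST FRAMING (cell `b2b-bsdres`, run/shared/lean/b2b/bsd-rank1-residual/, verbatim in every file):
the goal of the cell is to DELETE the COMBINATION-SHAPED residual classes of the Birch–Swinnerton-Dyer
formula for ALL analytic-rank `≤ 1` elliptic curves over `ℚ` — "full BSD formula for every rank `≤ 1`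
curve in class `C`" assembled STRICTLY from published theorems — so that the rank-`≤ 1` remainder
becomes exactly the CONSTRUCTION-SHAPED classes, which are TYPED (missing-input `Prop`s), NOT
attempted. This is not "finishing BSD". CLASS-OWNERS.md row "X1 (r = 1)": research route; NO CLAIM
BEYOND STATED CLASSES; nothing is booked by this file; no preprint enters; no named fact.

Unit `b2b-bsdres-x1a` (X1 prover A, gen 20). WHY. The tree's `PadicSigmaVeluKernelBridgeProofs`
(`sq_velu_image`, `formalEta_mul_velu_image`) and `VeluKernelReductionProofs`
(`map_veluFormalUnit_sub_one`, `map_veluFormalIsog_sub`) turn POLYNOMIAL data of a Vélu `p`-isogeny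
(`φ`, `U`, `M`; `f·M² = U³ + A₀Uφ⁴ + B₀φ⁶`, `U'φ - 2Uφ' = pM`, `U ≡ Xᵖ`, `M ≡ fⁿ`, `φ ≡ ℓ₀`) into the
POWER-SERIES data the analytic criterion `coeff_exp_sigmaExpArg_mem_of_isogeny` consumes (the image
`P = 𝒰u²` of the formal point satisfies the cleared Weierstrass equation of the target; `ψ^*ω_p = pω`
cleared; `u ≡ 1`, `t_p ≡ ℓ₀tᵖ (mod p)`) — but they are stated for SHORT models (`a₂ = 0`: the target
has no `x²` term and `M ≡ (X³ + a₄X + a₆)ⁿ`). At `p = 3` the ordinary family is the `a₂`-family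
(`X1/PadicSigmaThreeChart.lean`, `X1/PadicSigmaThreeIsogeny.lean`: the target is
`y² = x³ + a₂'x² + a₄'x + a₆'`), so this file re-proves the four lemmas for any `a₁ = a₃ = 0` model
(`IsCharNeTwoNF`, `f = rhsCubic = X³ + a₂X² + a₄X + a₆`) with the `a₂`-TERM in the target equation:
* `sq_velu_image_of_isCharNeTwoNF`: from `f·M² = U³ + A₂U²φ² + A₀Uφ⁴ + B₀φ⁶` to
  **`P² = P³ + A₂·t_p²·P² + A₀·t_p⁴·P + B₀·t_p⁶`** (`P = 𝒰u²`, `t_p = tΦu`, the tree's `veluFormalUnit`,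
  `veluFormalIsog`, which are defined for every model);
* `formalEta_mul_velu_image_scaled`: from `U'φ - 2Uφ' = pM` to **`η·(TP^• - 2PT^•) = -2(pc)P`** for
  `T = c·t_p` (the tree's proof verbatim — it never used `a₂ = 0` — plus the rescaling used downstream);
* `map_veluFormalUnit_sub_one_of_isCharNeTwoNF`, `map_veluFormalIsog_sub_of_isCharNeTwoNF`: from
  `U ≡ Xᵖ`, `M ≡ fⁿ`, `φ ≡ ℓ₀ (mod p)` to **`u ≡ 1`**, **`t_p ≡ ℓ₀tᵖ (mod p)`** (tree proofs with
  `X³ + a₄X + a₆` replaced by `rhsCubic`; `ev_{3n}(fⁿ) = X^{2n}` is the tree's `clearedEval_pow_rhsCubic`).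
Consumer: the `p = 3` assembly (modules M3b/M4 of the x1a design, HOME/b2b-bsdres-x1a/gen20/A34-P3-DESIGN.md
§3) with `(φ, U, M, p, n) = (kernelPoly, xNum, yNum, 3, 1)`, `(A₂, A₀, B₀) = (a₂'/Y², a₄'/Y⁴, a₆'/Y⁶)`,
`ℓ₀ = -Y`.

References: C. Blakestad, D. Grant, J. Number Theory 249 (2023) 348–376, Prop. 7 (a)–(c), Lemma 12
[BlakestadGrant2023]; J. Vélu, C. R. Acad. Sci. Paris 273 (1971) 238–241 (`ψ^*ω₁ = ω`) [Velu1971].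
Adapted from the tree files `Literature/NumberTheory/EllipticCurves/PadicSigmaVeluKernelBridgeProofs.lean`
and `…/VeluKernelReductionProofs.lean` (same statements with `a₂ = 0`).

Pure proof file: no definitions, no named facts, no `sorry`; standard axioms.
-/

noncomputable section

open PowerSeries Literature.NumberTheory.EllipticCurves
open scoped Polynomial

namespace Summit.BirchSwinnertonDyer.Rank1Residual.X1.PadicSigmaThree

open WeierstrassCurve

variable {𝒪 : Type*} [CommRing 𝒪] (W : WeierstrassCurve 𝒪) [W.IsCharNeTwoNF]

variable {W}
variable {φO U₀ M₀ : 𝒪[X]} {A₂ A₀ B₀ : 𝒪} {p n : ℕ}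

/-- **The cleared Weierstrass equation of `ψ` of the formal point, `a₂`-term kept.** From the model
`E'_p : y_p² = x_p³ + A₂x_p² + A₀x_p + B₀`, `x_p = U/φ²`, `y_p = yM/φ³`, i.e. the polynomial identity
`f·M² = U³ + A₂U²φ² + A₀Uφ⁴ + B₀φ⁶` (`f = X³ + a₂X² + a₄X + a₆`), the series `P = 𝒰·u²`
(`𝒰 = ev_p U`, `u = veluFormalUnit`) and `t_p = t·Φ·u` (`veluFormalIsog`) satisfy
**`P² = P³ + A₂·t_p²·P² + A₀·t_p⁴·P + B₀·t_p⁶`**. (The tree's `sq_velu_image` is the case `A₂ = 0`,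
`a₂ = 0`; same proof with one more term.) [Blakestad–Grant 2023, Prop. 7 (a),(c)]
[cite: BlakestadGrant2023, Prop. 7] -/
theorem sq_velu_image_of_isCharNeTwoNF (hp : 2 * n + 1 = p) (hφ : φO.natDegree ≤ n) (hU : U₀.natDegree ≤ p)
    (hM : M₀.natDegree ≤ 3 * n) (hM1 : M₀.coeff (3 * n) = 1)
    (hAB : W.rhsCubic * M₀ ^ 2 =
      U₀ ^ 3 + Polynomial.C A₂ * U₀ ^ 2 * φO ^ 2 + Polynomial.C A₀ * U₀ * φO ^ 4 + Polynomial.C B₀ * φO ^ 6) :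
    (W.clearedEval p U₀ * W.veluFormalUnit U₀ M₀ p n ^ 2) ^ 2 =
      (W.clearedEval p U₀ * W.veluFormalUnit U₀ M₀ p n ^ 2) ^ 3 +
        C A₂ * W.veluFormalIsog φO U₀ M₀ p n ^ 2 * (W.clearedEval p U₀ * W.veluFormalUnit U₀ M₀ p n ^ 2) ^ 2 +
        C A₀ * W.veluFormalIsog φO U₀ M₀ p n ^ 4 * (W.clearedEval p U₀ * W.veluFormalUnit U₀ M₀ p n ^ 2) +
        C B₀ * W.veluFormalIsog φO U₀ M₀ p n ^ 6 := by
  set 𝒰 := W.clearedEval p U₀ with h𝒰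
  set Φ := W.clearedEval n φO with hΦ
  set ℳ := W.clearedEval (3 * n) M₀ with hℳ
  set u := W.veluFormalUnit U₀ M₀ p n with hu
  have htp : W.veluFormalIsog φO U₀ M₀ p n = X * Φ * u := rfl
  have hunit : u * (W.formalXMulSq * ℳ) = 𝒰 := veluFormalUnit_mul hM hM1
  -- evaluate the polynomial identity at level `3p`
  have hdegf : W.rhsCubic.natDegree ≤ 3 := W.natDegree_rhsCubic_le
  have hM2 : (M₀ ^ 2).natDegree ≤ 3 * n + 3 * n := (Polynomial.natDegree_pow_le_of_le 2 hM).trans (by omega)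
  have hφ2 : (φO ^ 2).natDegree ≤ 2 * n := (Polynomial.natDegree_pow_le_of_le 2 hφ).trans (by omega)
  have hφ4 : (φO ^ 4).natDegree ≤ 4 * n := (Polynomial.natDegree_pow_le_of_le 4 hφ).trans (by omega)
  have hφ6 : (φO ^ 6).natDegree ≤ 6 * n := (Polynomial.natDegree_pow_le_of_le 6 hφ).trans (by omega)
  have hU2 : (U₀ ^ 2).natDegree ≤ p + p := (Polynomial.natDegree_pow_le_of_le 2 hU).trans (by omega)
  have hL : W.clearedEval (3 * p) (W.rhsCubic * M₀ ^ 2) = W.formalXMulSq ^ 2 * ℳ ^ 2 := by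
    rw [show 3 * p = 3 + (3 * n + 3 * n) by omega, W.clearedEval_mul hdegf hM2, clearedEval_rhsCubic_eq_sq,
      pow_two M₀, W.clearedEval_mul hM hM, ← hℳ, pow_two ℳ]
  have hR1 : W.clearedEval (3 * p) (U₀ ^ 3) = 𝒰 ^ 3 := by
    rw [show 3 * p = p + p + p by omega, pow_three', W.clearedEval_mul ((Polynomial.natDegree_mul_le).trans
      (add_le_add hU hU)) hU, W.clearedEval_mul hU hU, ← h𝒰]
    ring
  have hR0 : W.clearedEval (3 * p) (Polynomial.C A₂ * U₀ ^ 2 * φO ^ 2) = X ^ 2 * (C A₂ * 𝒰 ^ 2 * Φ ^ 2) := by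
    rw [show 3 * p = ((p + p) + 2 * n) + 1 by omega, W.clearedEval_add_right 1 (by
        rw [mul_assoc]; exact (Polynomial.natDegree_C_mul_le _ _).trans (Polynomial.natDegree_mul_le.trans (add_le_add hU2 hφ2))),
      mul_assoc, clearedEval_C_mul, W.clearedEval_mul hU2 hφ2, pow_two U₀, W.clearedEval_mul hU hU, ← h𝒰,
      show 2 * n = n + n by ring, pow_two φO, W.clearedEval_mul hφ hφ, ← hΦ]
    ring
  have hR2 : W.clearedEval (3 * p) (Polynomial.C A₀ * U₀ * φO ^ 4) = X ^ 4 * (C A₀ * 𝒰 * Φ ^ 4) := by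
    rw [show 3 * p = (p + 4 * n) + 2 by omega, W.clearedEval_add_right 2 (by
        rw [mul_assoc]; exact (Polynomial.natDegree_C_mul_le _ _).trans (Polynomial.natDegree_mul_le.trans (add_le_add hU hφ4))),
      mul_assoc, clearedEval_C_mul, W.clearedEval_mul hU hφ4, ← h𝒰,
      show 4 * n = n + n + n + n by ring, show φO ^ 4 = φO * φO * φO * φO by ring,
      W.clearedEval_mul ((Polynomial.natDegree_mul_le).trans (add_le_add ((Polynomial.natDegree_mul_le).trans
        (add_le_add hφ hφ)) hφ)) hφ,
      W.clearedEval_mul ((Polynomial.natDegree_mul_le).trans (add_le_add hφ hφ)) hφ, W.clearedEval_mul hφ hφ, ← hΦ]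
    ring
  have hR3 : W.clearedEval (3 * p) (Polynomial.C B₀ * φO ^ 6) = X ^ 6 * (C B₀ * Φ ^ 6) := by
    rw [show 3 * p = 6 * n + 3 by omega, W.clearedEval_add_right 3 ((Polynomial.natDegree_C_mul_le _ _).trans hφ6),
      clearedEval_C_mul, show 6 * n = n + n + n + n + n + n by ring,
      show φO ^ 6 = φO * φO * φO * φO * φO * φO by ring,
      W.clearedEval_mul ((Polynomial.natDegree_mul_le).trans (add_le_add ((Polynomial.natDegree_mul_le).trans
        (add_le_add ((Polynomial.natDegree_mul_le).trans (add_le_add ((Polynomial.natDegree_mul_le).trans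
        (add_le_add hφ hφ)) hφ)) hφ)) hφ)) hφ,
      W.clearedEval_mul ((Polynomial.natDegree_mul_le).trans (add_le_add ((Polynomial.natDegree_mul_le).trans
        (add_le_add ((Polynomial.natDegree_mul_le).trans (add_le_add hφ hφ)) hφ)) hφ)) hφ,
      W.clearedEval_mul ((Polynomial.natDegree_mul_le).trans (add_le_add ((Polynomial.natDegree_mul_le).trans
        (add_le_add hφ hφ)) hφ)) hφ,
      W.clearedEval_mul ((Polynomial.natDegree_mul_le).trans (add_le_add hφ hφ)) hφ, W.clearedEval_mul hφ hφ, ← hΦ]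
    ring
  have hev := congrArg (W.clearedEval (3 * p)) hAB
  rw [hL, clearedEval_add, clearedEval_add, clearedEval_add, hR1, hR0, hR2, hR3] at hev
  -- `X²ℳ²·u² = 𝒰²`; multiply by `u⁶`
  rw [htp]
  linear_combination u ^ 6 * hev - (u * (W.formalXMulSq * ℳ) + 𝒰) * u ^ 4 * hunit

/-- **`ψ^*ω' = π·ω`, cleared, for the RESCALED parameter `T = c·t_p`** (any `a₁ = a₃ = 0` model): with
`P = 𝒰u²`, `t_p = tΦu`, a scalar `c` (downstream `c = ℓ₀⁻¹`, `π = p·c = p/ℓ₀`) and the normalisation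
`U'φ - 2Uφ' = p·M` (`(U/φ²)' = pM/φ³`): **`η·(T·P^• - 2P·T^•) = -2(pc)·P`** (`η = dz/ω`, `Dx = 2y`).
For `c = 1` and a short model this is the tree's `formalEta_mul_velu_image`, whose proof (the pole-cleared
derivations `𝒟_{2p}𝒰 = -2ev_p(xU')`, `𝒟_{2n}Φ = -2ev_n(xφ')`) uses only `a₁ = a₃ = 0` and is repeated here.
[Blakestad–Grant 2023, Prop. 7 (c), Lemma 12; Vélu 1971] [cite: BlakestadGrant2023, Prop. 7] -/
theorem formalEta_mul_velu_image_scaled (c : 𝒪) (hp : 2 * n + 1 = p) (hφ : φO.natDegree ≤ n)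
    (hU : U₀.natDegree ≤ p) (hM : M₀.natDegree ≤ 3 * n) (hM1 : M₀.coeff (3 * n) = 1)
    (hMder : Polynomial.derivative U₀ * φO - 2 * U₀ * Polynomial.derivative φO = Polynomial.C (p : 𝒪) * M₀) :
    W.formalEta * ((C c * W.veluFormalIsog φO U₀ M₀ p n) * d⁄dX 𝒪 (W.clearedEval p U₀ * W.veluFormalUnit U₀ M₀ p n ^ 2) -
      2 * (W.clearedEval p U₀ * W.veluFormalUnit U₀ M₀ p n ^ 2) * d⁄dX 𝒪 (C c * W.veluFormalIsog φO U₀ M₀ p n)) =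
      -2 * C ((p : 𝒪) * c) * (W.clearedEval p U₀ * W.veluFormalUnit U₀ M₀ p n ^ 2) := by
  -- `(c·t_p)^• = c·t_p^•`: reduce to `c = 1`
  have hder : d⁄dX 𝒪 (C c * W.veluFormalIsog φO U₀ M₀ p n) = C c * d⁄dX 𝒪 (W.veluFormalIsog φO U₀ M₀ p n) := by
    rw [Derivation.leibniz, derivative_C, smul_zero, add_zero, smul_eq_mul]
  rw [hder]
  suffices hmain : W.formalEta * (W.veluFormalIsog φO U₀ M₀ p n * d⁄dX 𝒪 (W.clearedEval p U₀ * W.veluFormalUnit U₀ M₀ p n ^ 2) -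
      2 * (W.clearedEval p U₀ * W.veluFormalUnit U₀ M₀ p n ^ 2) * d⁄dX 𝒪 (W.veluFormalIsog φO U₀ M₀ p n)) =
      -2 * C (p : 𝒪) * (W.clearedEval p U₀ * W.veluFormalUnit U₀ M₀ p n ^ 2) by
    rw [show C ((p : 𝒪) * c) = C (p : 𝒪) * C c from map_mul C _ _]
    linear_combination C c * hmain
  set 𝒰 := W.clearedEval p U₀ with h𝒰
  set Φ := W.clearedEval n φO with hΦ
  set ℳ := W.clearedEval (3 * n) M₀ with hℳ
  set u := W.veluFormalUnit U₀ M₀ p n with hu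
  have htp : W.veluFormalIsog φO U₀ M₀ p n = X * Φ * u := rfl
  have hunit : u * (W.formalXMulSq * ℳ) = 𝒰 := veluFormalUnit_mul hM hM1
  have hDU := W.clearedDeriv_clearedEval_eq hU
  have hDΦ := W.clearedDeriv_clearedEval_eq hφ
  rw [← h𝒰] at hDU
  rw [← hΦ] at hDΦ
  have hXd : ∀ {Q : 𝒪[X]} {d : ℕ}, Q.natDegree ≤ d → (Polynomial.X * Polynomial.derivative Q).natDegree ≤ d := by
    intro Q d hQ
    by_cases h0 : Q.natDegree = 0
    · rw [Polynomial.derivative_of_natDegree_zero h0, mul_zero, Polynomial.natDegree_zero]; exact Nat.zero_le _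
    · refine (Polynomial.natDegree_mul_le).trans ?_
      have := Polynomial.natDegree_derivative_le Q
      have h1 : (Polynomial.X : 𝒪[X]).natDegree ≤ 1 := Polynomial.natDegree_X_le
      omega
  have hXU : (Polynomial.X * Polynomial.derivative U₀).natDegree ≤ p := hXd hU
  have hXφ : (Polynomial.X * Polynomial.derivative φO).natDegree ≤ n := hXd hφ
  have hkey : Φ * W.clearedEval p (Polynomial.X * Polynomial.derivative U₀) -
      2 * 𝒰 * W.clearedEval n (Polynomial.X * Polynomial.derivative φO) =
      C (p : 𝒪) * (W.formalXMulSq * ℳ) := by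
    have h1 : W.clearedEval (n + p) (φO * (Polynomial.X * Polynomial.derivative U₀)) =
        Φ * W.clearedEval p (Polynomial.X * Polynomial.derivative U₀) := by rw [W.clearedEval_mul hφ hXU, ← hΦ]
    have h2 : W.clearedEval (n + p) (U₀ * (Polynomial.X * Polynomial.derivative φO)) =
        𝒰 * W.clearedEval n (Polynomial.X * Polynomial.derivative φO) := by
      rw [add_comm, W.clearedEval_mul hU hXφ, ← h𝒰]
    have h3 : W.clearedEval (n + p) (Polynomial.X * (Polynomial.C (p : 𝒪) * M₀)) = C (p : 𝒪) * (W.formalXMulSq * ℳ) := by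
      rw [show n + p = 3 * n + 1 by omega, W.clearedEval_X_mul ((Polynomial.natDegree_C_mul_le _ _).trans hM),
        clearedEval_C_mul, ← hℳ]
      ring
    have hpol : φO * (Polynomial.X * Polynomial.derivative U₀) - 2 * (U₀ * (Polynomial.X * Polynomial.derivative φO)) =
        Polynomial.X * (Polynomial.C (p : 𝒪) * M₀) := by
      rw [← hMder]; ring
    have h4 := congrArg (W.clearedEval (n + p)) hpol
    rw [clearedEval_sub, show (2 : 𝒪[X]) * (U₀ * (Polynomial.X * Polynomial.derivative φO)) =
        Polynomial.C (2 : 𝒪) * (U₀ * (Polynomial.X * Polynomial.derivative φO)) by rw [map_ofNat],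
      clearedEval_C_mul, h1, h2, h3, map_ofNat] at h4
    linear_combination h4
  have hdefU : W.clearedDeriv (2 * p) 𝒰 = W.formalEta * (X * d⁄dX 𝒪 𝒰 - ((2 * p : ℕ) : 𝒪⟦X⟧) * 𝒰) := rfl
  have hdefΦ : W.clearedDeriv (2 * n) Φ = W.formalEta * (X * d⁄dX 𝒪 Φ - ((2 * n : ℕ) : 𝒪⟦X⟧) * Φ) := rfl
  have hpn : ((2 * p : ℕ) : 𝒪⟦X⟧) = 2 * ((2 * n : ℕ) : 𝒪⟦X⟧) + 2 := by
    rw [← hp]; push_cast; ring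
  rw [hpn] at hdefU
  rw [htp, show W.clearedEval p U₀ * u ^ 2 = 𝒰 * (u * u) by rw [h𝒰, pow_two]]
  simp only [Derivation.leibniz, derivative_X, smul_eq_mul]
  linear_combination (-(u ^ 3 * Φ)) * hdefU + (2 * u ^ 3 * 𝒰) * hdefΦ + (u ^ 3 * Φ) * hDU -
    (2 * u ^ 3 * 𝒰) * hDΦ - (2 * u ^ 3) * hkey - (2 * C (p : 𝒪) * u ^ 2) * hunit

/-- **`u ≡ 1 (mod p)`** for any `a₁ = a₃ = 0` model: modulo `p`, `𝒰 ≡ X^p` (`U ≡ x^p`) and `ℳ ≡ X^{2n}`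
(`M ≡ fⁿ`, `ev_{3n}(fⁿ) = X^{2n}`), so `ū·X̄^{2n+1} = X̄^p` with `X̄` a unit. (The tree's
`map_veluFormalUnit_sub_one` with `f = rhsCubic` in place of `X³ + a₄X + a₆`.) [Blakestad–Grant 2023,
Lemma 12] [cite: BlakestadGrant2023, Lemma 12] -/
theorem map_veluFormalUnit_sub_one_of_isCharNeTwoNF (hp : 2 * n + 1 = p)
    (hU : U₀.natDegree ≤ p) (hUp : ∀ i, (p : 𝒪) ∣ (U₀ - Polynomial.X ^ p).coeff i)
    (hM : M₀.natDegree ≤ 3 * n) (hM1 : M₀.coeff (3 * n) = 1)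
    (hMp : ∀ i, (p : 𝒪) ∣ (M₀ - W.rhsCubic ^ n).coeff i) :
    PowerSeries.map (Ideal.Quotient.mk (Ideal.span {(p : 𝒪)})) (W.veluFormalUnit U₀ M₀ p n - 1) = 0 := by
  set mk := Ideal.Quotient.mk (Ideal.span {(p : 𝒪)}) with hmk
  set Xs := W.formalXMulSq with hXs
  have hXp : (Polynomial.X ^ p : 𝒪[X]).natDegree ≤ p := Polynomial.natDegree_X_pow_le p
  have hU' : PowerSeries.map mk (W.clearedEval p U₀) = PowerSeries.map mk Xs ^ p := by
    have h := W.map_clearedEval_eq_zero (g := U₀ - Polynomial.X ^ p)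
      ((Polynomial.natDegree_sub_le _ _).trans (max_le hU hXp)) hUp
    rwa [clearedEval_sub, map_sub, sub_eq_zero, W.clearedEval_X_pow le_rfl, Nat.sub_self, mul_zero, pow_zero,
      mul_one, map_pow] at h
  have hfn : (W.rhsCubic ^ n).natDegree ≤ 3 * n :=
    Polynomial.natDegree_pow_le.trans ((Nat.mul_le_mul_left n W.natDegree_rhsCubic_le).trans (le_of_eq (mul_comm n 3)))
  have hM' : PowerSeries.map mk (W.clearedEval (3 * n) M₀) = PowerSeries.map mk Xs ^ (2 * n) := by
    have h := W.map_clearedEval_eq_zero (g := M₀ - W.rhsCubic ^ n) ((Polynomial.natDegree_sub_le _ _).trans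
      (max_le hM hfn)) hMp
    rwa [clearedEval_sub, map_sub, sub_eq_zero, W.clearedEval_pow_rhsCubic, map_pow] at h
  have hid := congrArg (PowerSeries.map mk) (veluFormalUnit_mul (W := W) (U₀ := U₀) (p := p) hM hM1)
  rw [map_mul, map_mul, hU', hM', ← hXs, ← pow_succ', hp] at hid
  have hXsu : PowerSeries.map mk Xs ^ p * (PowerSeries.map mk Xs ^ p).invOfUnit 1 = 1 :=
    PowerSeries.mul_invOfUnit _ _ (by rw [map_pow, ← PowerSeries.coeff_zero_eq_constantCoeff, PowerSeries.coeff_map,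
      PowerSeries.coeff_zero_eq_constantCoeff, hXs, W.constantCoeff_formalXMulSq, map_one, one_pow, Units.val_one])
  rw [map_sub, map_one]
  linear_combination (PowerSeries.map mk Xs ^ p).invOfUnit 1 * hid -
    (PowerSeries.map mk (W.veluFormalUnit U₀ M₀ p n) - 1) * hXsu

/-- **`t_p ≡ ℓ₀·t^p (mod p)`** for any `a₁ = a₃ = 0` model (`ℓ₀ = φ(0)`): modulo `p`, `Φ ≡ ℓ₀t^{2n}`
and `u ≡ 1`. (The tree's `map_veluFormalIsog_sub` with `f = rhsCubic`.) [Blakestad–Grant 2023, Prop. 7(c)]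
[cite: BlakestadGrant2023, Prop. 7] -/
theorem map_veluFormalIsog_sub_of_isCharNeTwoNF (hp : 2 * n + 1 = p)
    (hφ : φO.natDegree ≤ n) (hφp : ∀ i, 1 ≤ i → (p : 𝒪) ∣ φO.coeff i)
    (hU : U₀.natDegree ≤ p) (hUp : ∀ i, (p : 𝒪) ∣ (U₀ - Polynomial.X ^ p).coeff i)
    (hM : M₀.natDegree ≤ 3 * n) (hM1 : M₀.coeff (3 * n) = 1)
    (hMp : ∀ i, (p : 𝒪) ∣ (M₀ - W.rhsCubic ^ n).coeff i) :
    PowerSeries.map (Ideal.Quotient.mk (Ideal.span {(p : 𝒪)}))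
      (W.veluFormalIsog φO U₀ M₀ p n - PowerSeries.C (φO.coeff 0) * PowerSeries.X ^ p) = 0 := by
  set mk := Ideal.Quotient.mk (Ideal.span {(p : 𝒪)}) with hmk
  have hu := map_veluFormalUnit_sub_one_of_isCharNeTwoNF (W := W) hp hU hUp hM hM1 hMp
  rw [map_sub, map_one, sub_eq_zero] at hu
  have hΦ : PowerSeries.map mk (W.clearedEval n φO) = PowerSeries.C (mk (φO.coeff 0)) * PowerSeries.X ^ (2 * n) := by
    have hdeg : (φO - Polynomial.C (φO.coeff 0)).natDegree ≤ n :=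
      (Polynomial.natDegree_sub_le _ _).trans (max_le hφ (by rw [Polynomial.natDegree_C]; exact Nat.zero_le _))
    have hdvd : ∀ i, (p : 𝒪) ∣ (φO - Polynomial.C (φO.coeff 0)).coeff i := by
      intro i
      rw [Polynomial.coeff_sub, Polynomial.coeff_C]
      split_ifs with hi
      · rw [hi, sub_self]; exact dvd_zero _
      · rw [sub_zero]; exact hφp i (Nat.one_le_iff_ne_zero.mpr hi)
    have h := W.map_clearedEval_eq_zero hdeg hdvd
    rwa [clearedEval_sub, map_sub, sub_eq_zero, show Polynomial.C (φO.coeff 0) = Polynomial.C (φO.coeff 0) *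
      Polynomial.X ^ 0 by rw [pow_zero, mul_one], W.clearedEval_C_mul_X_pow (Nat.zero_le n), pow_zero, one_mul,
      Nat.sub_zero, map_mul, map_pow, PowerSeries.map_C, PowerSeries.map_X] at h
  rw [map_sub, veluFormalIsog, map_mul, map_mul, hu, hΦ, PowerSeries.map_X, mul_one, map_mul, map_pow,
    PowerSeries.map_C, PowerSeries.map_X,
    show (PowerSeries.X ^ p : PowerSeries (𝒪 ⧸ Ideal.span {(p : 𝒪)})) = PowerSeries.X ^ (2 * n) * PowerSeries.X by
      rw [← pow_succ, hp]]
  ring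

end Summit.BirchSwinnertonDyer.Rank1Residual.X1.PadicSigmaThree

end
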